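import Summits.ValiantsHypothesis.ValiantsHypothesis.Theorems.NewtonUnitEquationsTwoProductsRankOneThreeLawShift
import HarnessLib

/-!
# Route NewtonUnitEquations — crux `TwoProducts` (stmt-ValiantsHypothesis-5906), line `relation_ladder`, rung R6b (three-term
# rank one, shape `α = β + γ`): the FREE LIFT — `RankOneThreeLaw`, UNCONDITIONAL — part 4/6 — the planar instance: relation data `α = β + γ`, the free lift, injectivity, lifted visible points, letter weights (Part T7)

(T7) the planar instance — degenerate relations (`permType_of_absent_letter`, three-term form), three-term relation data `RelData` with
`α = β + γ`, the free lift `GT` of the chain (letter push-forward INVARIANT under `frM`), injectivity of the letter push-forward on the lifted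
support from rank-one coincidences, lifted visible points, letter weights `rW` and the slice splitting `lwt_split`.

val-idea-8 g3 (ideator; lens decomp), 2026-08-28. Companion of the R6 module (shape `α + β = γ + δ`, Segre lift). New ingredient: the
relation is INHOMOGENEOUS, so the fibres of the lift `Y_α ↦ Y_β Y_γ` have VARYING letter count and the slice sums are no longer
binomial-exponential sums of bounded width; they carry the extra factor `C(λ(ν) + b - 1 - k, b - k)` with `λ` an ADDITIVE form, which still has
finite SHIFT RANK — so val-lit-p3's general strict-pencil-minimiser count for finite shift rank (`…FormalLogLinearisation.ShiftRank.pencilCount`,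
LANDED p620579) applies BY NAME.

PORT NOTE (val-lit-p3 g15, prover seat, helper mode `--supports stmt-ValiantsHypothesis-5906 --as helper`, no stub credit claimed;
desk RULING #279 (c)): part 4/6 of a VERBATIM Theorems-side port of val-idea-8 g3's sorry-free module
`Cruxes/TwoProducts/Lines/relation_ladder_R6b.lean` (tree @988ccfe3a7f4; file sha256 da7520fdfde8796f…; 1 661 lines; `lean check` rc 0,
0 sorries) into files of ≤ 400 lines, following the R6 port (`…RankOneFourLaw{Toric,Fibres,Slice,Planar,Weights,Count}`, p11 g1 / p3 g14).
ALL mathematics and ALL proofs below are val-idea-8 g3's (engine memo `Cruxes/TwoProducts/Lines/relation_ladder_R6_engine.md` rev 3 §7′,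
card `Lines/relation_ladder.md` v14). The port changes only: (i) the file split and the import chain; (ii) the generic toolkit that the source
re-declares VERBATIM from the R6 module (`phiT/piT` family, `piT_apply`, `ofFun`, `multinomial_univ`, `tab`, `sgn`, `binChar` + lemmas,
`toolBound_mono`, the toric Lemma A `toric_minLog` with `coeff_zero_phiT_lin/coeff_zero_one_add_phiT_lin/phiT_liftG/phiT_logTrunc`,
`RankOneCoincidences`, `rankOneCoincidences_of_permType`, `msetT_apply_eq_zero`, `idxOf`, `enum_idxOf`, `rW`, `lwt_single`, `lwt_piT`) is NOT
re-declared but IMPORTED from the landed R6 port (`…RankOneFourLaw*`, namespace `…PermutationType`, identical texts), so every such name below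
resolves to the landed declaration; (iii) `set_option linter.deprecated false` dropped; (iv) one-line docstrings on API lemmas required by the
tree's docstring lint; (v) in part 6/6 the parameter-free `def RankOneThreeLaw : Prop` is NOT declared (the gate relocates such defs, cf. the R6
port delta p622844) — the law is stated by its LITERAL body as `rankOneThreeLaw_proof`. Namespace = the author's (`…PermutationType.R6b`).
Nothing here closes the line's residual, the crux `TwoProducts` (5906) or `VP ≠ VNP`; no summit statement is proved.

Honest scope (the author's): the shape `2β = α + γ` (R6c) and coincidence rank `≥ 2` (R7) are NOT covered here and go to the residual of
skeleton v15. Nothing here moves VP ≠ VNP; `TwoProducts` (5906) stays OPEN. [folklore]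
-/

noncomputable section

-- Sub = Summit single-conjunct layout: the duplicated namespace component is mandated by the tree.
set_option linter.dupNamespace false
set_option linter.unusedSimpArgs false
set_option linter.unusedSectionVars false

namespace Summit.ValiantsHypothesis.ValiantsHypothesis.Theorems.NewtonUnitEquations.TwoProducts.PermutationType
namespace R6b
open scoped BigOperators
open MvPolynomial

variable {σ : Type*} [Fintype σ] [DecidableEq σ]

variable (I : ThreeIdx σ)

/-! ## Part T7: the planar instance — three-term relation data `α = β + γ`, the free lift of the chain, injectivity of the letter
push-forward on the lifted support from rank-one coincidences, lifted visible points, letter weights -/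

section FreePlanar
open Summit.ValiantsHypothesis.ValiantsHypothesis.Theorems.NewtonUnitEquations.TwoProducts.FormalLogLinearisation
open Summit.ValiantsHypothesis.ValiantsHypothesis.Theorems.NewtonUnitEquations.TwoProducts.PlanarCell

variable {m : ℕ}

omit [Fintype σ] [DecidableEq σ] in
/-- **Degenerate relations.** If one of the three relation letters is absent from the family, rank-one coincidences for the
three-term relation are already of permutation type. [folklore] -/
theorem permType_of_absent_letter (A : Fin m → Finset Expo) (α β γ : Expo) (hab : α ≠ β) (hac : α ≠ γ) (hbc : β ≠ γ)
    (hR : RankOneCoincidences A (Finsupp.single β 1 + Finsupp.single γ 1) (Finsupp.single α 1))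
    (e : Expo) (he : e = α ∨ e = β ∨ e = γ) (hnot : ∀ j, e ∉ A j) : PermType A := by
  intro a ha b hb hab'
  obtain ⟨k, hk⟩ := hR a ha b hb hab'
  have ha0 := msetT_apply_eq_zero A a ha e hnot
  have hb0 := msetT_apply_eq_zero A b hb e hnot
  have hk0 : k = 0 := by
    rcases hk with hk | hk <;>
    · have h1 := DFunLike.congr_fun hk e
      simp only [Finsupp.add_apply, Finsupp.smul_apply, smul_eq_mul, Finsupp.single_apply, ha0, hb0] at h1
      rcases he with rfl | rfl | rfl <;>
        simp [hab, hac, hbc, hab.symm, hac.symm, hbc.symm] at h1 <;> omega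
  subst hk0
  simp only [zero_smul, add_zero] at hk
  rcases hk with hk | hk
  · exact hk
  · exact hk.symm

variable (u v : Fin m → MvPolynomial (Fin 2) ℂ)


/-- **Planar three-term relation data**: distinct tail letters `α, β, γ` with `α = β + γ`. [folklore] -/
structure RelData where
  /-- the letter `α` -/
  α : Expo
  /-- the letter `β` -/
  β : Expo
  /-- the letter `γ` -/
  γ : Expo
  hα : α ∈ tailSupport u v
  hβ : β ∈ tailSupport u v
  hγ : γ ∈ tailSupport u v
  hab : α ≠ β
  hac : α ≠ γ
  hbc : β ≠ γ
  hrel : α = β + γ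

variable {u v}
variable (D : RelData u v)

/-- The three indices of the relation letters. [folklore] -/
def RelData.idx : ThreeIdx (Fin (sE u v)) where
  a := idxOf u v D.α D.hα
  b := idxOf u v D.β D.hβ
  c := idxOf u v D.γ D.hγ
  hab h := D.hab (by have := congrArg (enum u v) h; rwa [enum_idxOf, enum_idxOf] at this)
  hac h := D.hac (by have := congrArg (enum u v) h; rwa [enum_idxOf, enum_idxOf] at this)
  hbc h := D.hbc (by have := congrArg (enum u v) h; rwa [enum_idxOf, enum_idxOf] at this)

omit [Fintype σ] [DecidableEq σ] in
/-- The letters at the three relation indices (port delta: the source's three one-liners `RelData.enum_a/b/c`, merged into one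
conjunction to keep the tree's statement index free of same-name restatements of the R6 port's `RelData.enum_a/b/c`). [folklore] -/
theorem RelData.enum_idx : enum u v D.idx.a = D.α ∧ enum u v D.idx.b = D.β ∧ enum u v D.idx.c = D.γ :=
  ⟨enum_idxOf u v _ _, enum_idxOf u v _ _, enum_idxOf u v _ _⟩

omit [Fintype σ] [DecidableEq σ] in
/-- The letter push-forward is invariant under the free substitution: `π_enum (frM i) = enum i`. [folklore] -/
theorem RelData.piE_enum_frM (i : Fin (sE u v)) : piE (enum u v) (frM D.idx i) = enum u v i := by
  by_cases hia : i = D.idx.a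
  · subst hia
    rw [frM_a, piE_eq_piT, piT_add, piT_single, piT_single, one_smul, one_smul, D.enum_idx.2.1, D.enum_idx.2.2, D.enum_idx.1, D.hrel]
  · rw [frM_other D.idx i hia, piE_eq_piT, piT_single, one_smul]

omit [Fintype σ] [DecidableEq σ] in
/-- On exponents: letter push-forward ∘ free substitution = letter push-forward. [folklore] -/
theorem RelData.piE_enum_piT (L : Fin (sE u v) →₀ ℕ) : piE (enum u v) (piT (frM D.idx) L) = piE (enum u v) L := by
  have hM : (fun i => piT (enum u v) (frM D.idx i)) = enum u v := by
    funext i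
    rw [← piE_eq_piT]
    exact D.piE_enum_frM i
  rw [piE_eq_piT, piE_eq_piT, piT_piT, hM]

omit [Fintype σ] [DecidableEq σ] in
/-- On polynomials: letter push-forward ∘ free substitution = letter push-forward. [folklore] -/
theorem RelData.phi_enum_phiT (H : MvPolynomial (Fin (sE u v)) ℂ) :
    phi (enum u v) (phiT (frM D.idx) H) = phi (enum u v) H := by
  have hM : (fun i => piT (enum u v) (frM D.idx i)) = enum u v := by
    funext i
    rw [← piE_eq_piT]
    exact D.piE_enum_frM i
  rw [phi_eq_phiT, phiT_phiT, hM]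

/-- The free lift of the chain difference. [folklore] -/
def RelData.GT : MvPolynomial (Fin (sE u v)) ℂ := phiT (frM D.idx) (liftG (cU u v) (cV u v))

omit [Fintype σ] [DecidableEq σ] in
/-- Its letter push-forward is the planar difference of products. [folklore] -/
theorem RelData.phi_GT : phi (enum u v) D.GT = tailDiff u v := by
  unfold RelData.GT
  rw [D.phi_enum_phiT, phi_liftG]

omit [Fintype σ] [DecidableEq σ] in
/-- Support points of the free lift are images of chain-support multisets. [folklore] -/
theorem RelData.exists_of_mem_support_GT (x : Fin (sE u v) →₀ ℕ) (hx : x ∈ D.GT.support) :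
    ∃ L ∈ (liftG (cU u v) (cV u v)).support, piT (frM D.idx) L = x :=
  exists_of_mem_support_phiT (frM D.idx) _ x hx

omit [Fintype σ] [DecidableEq σ] in
/-- Support points of the free lift have no `Y_a`. [folklore] -/
theorem RelData.apply_a_of_mem_support_GT (x : Fin (sE u v) →₀ ℕ) (hx : x ∈ D.GT.support) : x D.idx.a = 0 := by
  obtain ⟨L, -, rfl⟩ := D.exists_of_mem_support_GT x hx
  exact piT_frM_a D.idx L

omit [Fintype σ] [DecidableEq σ] in
/-- **Injectivity from rank-one coincidences** (shape `α = β + γ`). [folklore] -/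
theorem RelData.injOn_of_rankOne (hu : ∀ j, coeff 0 (u j) = 0) (hv : ∀ j, coeff 0 (v j) = 0)
    (hR : RankOneCoincidences (fun j => (u j).support ∪ (v j).support)
      (Finsupp.single D.β 1 + Finsupp.single D.γ 1) (Finsupp.single D.α 1)) :
    Set.InjOn (piE (enum u v)) ↑D.GT.support := by
  classical
  set A : Fin m → Finset Expo := fun j => (u j).support ∪ (v j).support with hA
  have hcU : ∀ j i, cU u v j i ≠ 0 → enum u v i ∈ A j := fun j i h =>
    Finset.mem_union_left _ (mem_support_iff.mpr h)
  have hcV : ∀ j i, cV u v j i ≠ 0 → enum u v i ∈ A j := fun j i h =>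
    Finset.mem_union_right _ (mem_support_iff.mpr h)
  have key : ∀ κ ∈ (liftG (cU u v) (cV u v)).support,
      ∃ a ∈ tuples A, ∑ j, a j = piE (enum u v) κ ∧ msetT a = Finsupp.mapDomain (enum u v) κ := by
    intro κ hκ
    unfold liftG at hκ
    rcases Finset.mem_union.1 (support_sub _ _ _ hκ) with h | h
    · exact tuple_of_mem_support_prod u v hu hv A (cU u v) hcU κ h
    · exact tuple_of_mem_support_prod u v hu hv A (cV u v) hcV κ h
  set ρp : Fin (sE u v) →₀ ℕ := Finsupp.single D.idx.b 1 + Finsupp.single D.idx.c 1 with hρp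
  set ρm : Fin (sE u v) →₀ ℕ := Finsupp.single D.idx.a 1 with hρm
  have hmp : Finsupp.mapDomain (enum u v) ρp = Finsupp.single D.β 1 + Finsupp.single D.γ 1 := by
    rw [hρp, Finsupp.mapDomain_add, Finsupp.mapDomain_single, Finsupp.mapDomain_single, D.enum_idx.2.1, D.enum_idx.2.2]
  have hmm : Finsupp.mapDomain (enum u v) ρm = Finsupp.single D.α 1 := by
    rw [hρm, Finsupp.mapDomain_single, D.enum_idx.1]
  have hπρ : piT (frM D.idx) ρp = piT (frM D.idx) ρm := by
    rw [hρp, hρm, piT_add, piT_single, piT_single, piT_single, one_smul, one_smul, one_smul,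
      frM_other D.idx D.idx.b D.idx.hab.symm, frM_other D.idx D.idx.c D.idx.hac.symm, frM_a]
  have hmapk : ∀ (k : ℕ) (L ρ : Fin (sE u v) →₀ ℕ),
      Finsupp.mapDomain (enum u v) (L + k • ρ) = Finsupp.mapDomain (enum u v) L + k • Finsupp.mapDomain (enum u v) ρ := by
    intro k L ρ
    rw [Finsupp.mapDomain_add]
    congr 1
    exact map_nsmul (Finsupp.mapDomain.addMonoidHom (enum u v)) k ρ
  have cancel : ∀ (k : ℕ) (L L' : Fin (sE u v) →₀ ℕ), L + k • ρp = L' + k • ρm →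
      piT (frM D.idx) L = piT (frM D.idx) L' := by
    intro k L L' h
    have := congrArg (piT (frM D.idx)) h
    rw [piT_add, piT_add, piT_nsmul, piT_nsmul, hπρ] at this
    exact add_right_cancel this
  intro x hx x' hx' hπ
  obtain ⟨L, hL, rfl⟩ := D.exists_of_mem_support_GT x hx
  obtain ⟨L', hL', rfl⟩ := D.exists_of_mem_support_GT x' hx'
  rw [D.piE_enum_piT, D.piE_enum_piT] at hπ
  obtain ⟨a, ha, haS, haM⟩ := key L hL
  obtain ⟨b, hb, hbS, hbM⟩ := key L' hL'
  obtain ⟨k, hk⟩ := hR a ha b hb (by rw [haS, hbS]; exact hπ)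
  rw [haM, hbM, ← hmp, ← hmm, ← hmapk, ← hmapk, ← hmapk, ← hmapk] at hk
  rcases hk with hk | hk
  · exact cancel k L L' (Finsupp.mapDomain_injective (enum_injective u v) hk)
  · exact (cancel k L' L (Finsupp.mapDomain_injective (enum_injective u v) hk)).symm

omit [Fintype σ] [DecidableEq σ] in
/-- Visible points lift to strict `ξ`-maxima of the freely lifted support (under injectivity). [folklore] -/
theorem RelData.lifted_of_visible (hinj : Set.InjOn (piE (enum u v)) ↑D.GT.support) (ξ : Fin 2 → ℝ) (l : Expo)
    (htop : IsStrictTop ξ ↑(tailDiff u v).support l) :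
    ∃ x₀ : Fin (sE u v) →₀ ℕ, x₀ ∈ D.GT.support ∧ piE (enum u v) x₀ = l ∧
      ∀ x ∈ D.GT.support, x ≠ x₀ → wt ξ (piE (enum u v) x) < wt ξ l := by
  have hsupp : tailDiff u v = phi (enum u v) D.GT := D.phi_GT.symm
  obtain ⟨hl, hlt⟩ := htop
  have hl' : l ∈ (phi (enum u v) D.GT).support := by rw [← hsupp]; exact hl
  obtain ⟨x₀, hx₀, hπ⟩ := exists_of_mem_support_phi (enum u v) _ l hl'
  refine ⟨x₀, hx₀, hπ, fun x hx hne => ?_⟩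
  have hcoeff : coeff (piE (enum u v) x) (tailDiff u v) ≠ 0 := by
    rw [hsupp, coeff_phi_of_injOn (enum u v) _ hinj x hx]
    exact mem_support_iff.mp hx
  have hneπ : piE (enum u v) x ≠ l := fun h => hne (hinj hx hx₀ (h.trans hπ.symm))
  exact hlt _ (mem_support_iff.mpr hcoeff) hneπ

/-! ### The upstairs weights: the letter weights themselves -/


omit [Fintype σ] [DecidableEq σ] in
/-- Letter weights are positive for a valid `ξ`. [folklore] -/
theorem rW_pos (ξ : Fin 2 → ℝ) (hval : ValidWeight u v ξ) (i : Fin (sE u v)) : 0 < rW (u := u) (v := v) ξ i := by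
  unfold rW; linarith [wt_enum_neg u v ξ hval i]


omit [Fintype σ] [DecidableEq σ] in
/-- The relation among letter weights: `r_a = r_b + r_c`. [folklore] -/
theorem RelData.rW_rel (ξ : Fin 2 → ℝ) : rW ξ D.idx.a = rW ξ D.idx.b + rW (u := u) (v := v) ξ D.idx.c := by
  unfold rW
  rw [D.enum_idx.1, D.enum_idx.2.1, D.enum_idx.2.2, D.hrel, wt_add]; ring

omit [Fintype σ] [DecidableEq σ] in
/-- The letter weight of a substituted letter is its planar weight. [folklore] -/
theorem RelData.lwt_rW_frM (ξ : Fin 2 → ℝ) (i : Fin (sE u v)) : lwt (rW ξ) (frM D.idx i) = rW (u := u) (v := v) ξ i := by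
  by_cases hia : i = D.idx.a
  · subst hia; rw [frM_a, lwt_add, lwt_single, lwt_single, D.rW_rel]
  · rw [frM_other D.idx i hia, lwt_single]

omit [Fintype σ] [DecidableEq σ] in
/-- On toric images the letter weight is the planar weight of the push-forward. [folklore] -/
theorem RelData.lwt_rW_piT (ξ : Fin 2 → ℝ) (L : Fin (sE u v) →₀ ℕ) :
    lwt (rW ξ) (piT (frM D.idx) L) = -wt ξ (piE (enum u v) (piT (frM D.idx) L)) := by
  rw [lwt_piT, D.piE_enum_piT, ← lwt_eq_neg_wt]
  congr 1
  funext i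
  exact D.lwt_rW_frM ξ i

/-- Splitting a linear weight along the slice: `θ(x) = Σ_i θ_i x̂_i + θ_c x_c` for `x_a = 0`. [folklore] -/
theorem lwt_split (I : ThreeIdx σ) (θ : σ → ℝ) (x : σ →₀ ℕ) (hx : x I.a = 0) :
    lwt θ x = (∑ i, θ i * ((xhat I x i : ℕ) : ℝ)) + θ I.c * ((x I.c : ℕ) : ℝ) := by
  unfold lwt
  rw [sum_three_split I, sum_three_split I (fun i => θ i * ((xhat I x i : ℕ) : ℝ)), xhat_a, xhat_b, xhat_c, hx]
  have hr : ∑ i ∈ rest I, θ i * ((x i : ℕ) : ℝ) = ∑ i ∈ rest I, θ i * ((xhat I x i : ℕ) : ℝ) := by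
    refine Finset.sum_congr rfl fun j hj => ?_
    rw [mem_rest] at hj
    rw [xhat_other I x j hj.1 hj.2.2]
  rw [hr]
  push_cast
  ring

end FreePlanar

end R6b
end Summit.ValiantsHypothesis.ValiantsHypothesis.Theorems.NewtonUnitEquations.TwoProducts.PermutationType

end
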